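import Summits.Ventures.CertifiedManyBodySolver.Downfold.BoxesHg1201EFillingPadding
import HarnessLib

/-!
# HgBa₂CuO₄₊δ «Hg-1201», object E @10 GPa (M19P10): THE PADDING CORNER BY VALUE — rectangular sub-boxes `boxHg1201E_M19P10_slice3` of the @10 box, the
# certificate strip `R′₁₀ = U ∈ [3, 17/2] × t′ ∈ [−49/100, −47/100] × n ∈ [43/50, 22/25]` typed (1/28 of the typed box; 1/56 after the t′-cut −12/25), the
# registered leaf «MOS2-hg1201-M19P10» EQUIVALENT to the stiffness word on it, and every rectangle avoiding that corner certificate-free at ANY `U` ends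

Venture CertifiedManyBodySolver, cell `pub/hubbard-downfold` (MO-S1 ↔ S2 seam; D-0154 (1)(C) COVERAGE, material (ii) Hg-1201 — THE PRESSURE LEG), seat
`hubbard-cov-hg1201-unc-2` (g2, session `prover-hubbard-cov-hg1201-unc-2-g0-0`); namespace `Summit.Ventures.CertifiedManyBodySolver.Downfold`. The @10 twin of
`Downfold/BoxesHg1201EPaddingCorner.lean` (p626450, same seat) for route `CovHg1201M19P10` (items stmt-Ventures-27104 «PatchLeftEdgeP10» / -27105 «PatchBottomP10»),
composed with hubbard-cov-hg1201-box-2's @10 kinematic slabs of record (every `U`): `hg1201M19P10_bar_kinematic_of_n_le_43o50` (`t′ ∈ [−49/100, −7/20] × n ∈ [0, 43/50]`,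
`Downfold/BoxesHg1201EP10KinematicCoverN.lean` p621284), `hg1201M19P10_bar_kinematic_of_m47o100_le_tp` (`t′ ∈ [−47/100, −7/20] × n ∈ [0, 22/25]`,
`Downfold/BoxesHg1201EP10StiffnessKinematic.lean` p610598) and the strip reduction `Hg1201M19P10_StiffnessBoxCeiling_of_cornerStrip`. The t′-cut `t*′ = −12/25` =
hubbard-cov-hg1201-unc-3 g5's «TP-KINCUT» exact `M = 512` scan (row `B(−12/25, 4273/8192) ≤ 0.2456919725`, reading `0.4751989 ≤ 0.4767609`) ADOPTED by captain
hubbard-cov-hg1201-plan-1 (hubbard-obs STATUS 2026-08-28T10:37:56Z; box-2 g1 types it — NOT in the tree at this writing ⇒ the `R″₁₀` statements are CONDITIONAL on a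
hypothesis of box-2's shape). Boxes: `boxHg1201E_M19P10` (typed, `n ∈ [4/5, 22/25]`) and the box OF RECORD `boxHg1201E_M19P10nR` (`n ∈ [79/100, 22/25]`, R-mg (e), p609726).

WHAT IS TYPED
* §0 `boxHg1201E_M19P10_slice3` (any rational ends) + `…_mem_iff`, refinements into `boxHg1201E_M19P10` / `boxHg1201E_M19P10nR`, monotonicity, the banking door
  (cell leaf ⇒ slice word / grammar word) and its inverse (slice word ⇒ cell leaf; dummy point with `t = 3/5`, `t″ = 0`).
* §1 `boxHg1201E_M19P10_Rprime` / `…_Rsecond` (t′ top `−12/25`), `R″₁₀ ⊆ R′₁₀ ⊆ M19P10 ⊆ nR`, fractions `|R′₁₀|/|M19P10| = (1/7)(1/4) = 1/28`,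
  `|R″₁₀|/|M19P10| = (1/14)(1/4) = 1/56`, and relative to the box of record (n-width `9/100`): `(1/7)(2/9) = 2/63`, `(1/14)(2/9) = 1/63`.
* §2 every rectangle avoiding the corner is certificate-free at the P10 bar, ANY `U` ends: `…_slice3_belowCut_…` (`n ⊆ [0, 43/50]`), `…_slice3_innerTp_…` (`t′ ⊆ [−47/100, −7/20]`).
* §3 **`Hg1201M19P10_StiffnessBoxCeiling_iff_RprimeWord`** and the CONDITIONAL `…_iff_RsecondWord_of_tpCut`; producers' door `boxHg1201E_M19P10_Rprime_stiffnessBoxCeilingBelow_of_cellLeaf`.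

Everything here is PROVED (definitions with bodies; no `sorry`, no new axiom). HONEST FRAMING: set algebra + composition with box-2's one-body kinematic theorems,
nothing about HgBa₂CuO₄₊δ or about pressure physics; `R′₁₀`/`R″₁₀` are CONDITIONAL-BY-NAME domains (the captain's strips), never boxes of record; no hull / row / word /
bar / leaf / item is moved — items 27104/27105 stay owed AS TYPED; stiffness statements are one-sided CEILINGS — CONTROL / CALIBRATION wording class (xx1), silent
on the presence of superconductivity; not a `T_c`, phase or `dT_c/dP` sentence; no summit statement is proved here.

References: D. J. Scalapino, S. R. White, S.-C. Zhang, PRB 47 (1993) 7995, §II [ScalapinoWhiteZhang1993]; T. Hazra, N. Verma, M. Randeria, PRX 9 (2019)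
031049, eqs. (2)–(6) [HazraVermaRanderia2019].
-/

noncomputable section

namespace Summit.Ventures.CertifiedManyBodySolver.Downfold
open Set NonemptyInterval Summit.Ventures.CertifiedManyBodySolver.Observables Literature.MathematicalPhysics.QuantumLattice

/-! ## §0 Rectangular sub-boxes of the @10 box BY VALUE -/

/-- **The @10 rectangular sub-box BY VALUE**: `boxHg1201E_M19P10` with `U/t ∈ [ulo, uhi]`, `t′/t ∈ [tlo, thi]`, `n ∈ [nlo, nhi]` re-issued (any rational ends with
`lo ≤ hi`); the `t = [51/100, 17/25]` and `t″ = 0` rows kept. [folklore] -/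
def boxHg1201E_M19P10_slice3 (ulo uhi tlo thi nlo nhi : ℚ) (hu : ulo ≤ uhi) (ht : tlo ≤ thi) (hn : nlo ≤ nhi) : OneBandBox :=
  ((boxHg1201E_M19P10.withEntry .UOverT (Entry.ofEnds ulo uhi hu .screening)).withEntry .tpOverT
      (Entry.ofEnds tlo thi ht .screening)).withEntry .filling (Entry.ofEnds nlo nhi hn .screening)

/-- A box point with prescribed `(U, t′, n)` and the @10-admissible dummy values `t = 3/5`, `t″ = 0` (the stiffness word reads only `(t′, U, n)`). [folklore] -/
def hg1201E_padPointP10 (U tp n : ℝ) : OneBandCoord → ℝ := fun c =>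
  match c with
  | .UOverT => U
  | .tpOverT => tp
  | .filling => n
  | .tEV => 3/5
  | _ => 0

/-- Accessors of the dummy point (by `rfl`). [folklore] -/
theorem hg1201E_padPointP10_apply (U tp n : ℝ) :
    hg1201E_padPointP10 U tp n .UOverT = U ∧ hg1201E_padPointP10 U tp n .tpOverT = tp ∧ hg1201E_padPointP10 U tp n .filling = n ∧
    hg1201E_padPointP10 U tp n .tEV = 3/5 ∧ hg1201E_padPointP10 U tp n .tppOverT = 0 :=
  ⟨rfl, rfl, rfl, rfl, rfl⟩

section
variable {ulo uhi tlo thi nlo nhi : ℚ} (hu : ulo ≤ uhi) (ht : tlo ≤ thi) (hn : nlo ≤ nhi)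

/-- **Membership in the @10 rectangle, unfolded**: the three new intervals and the @10 `t`, `t″` rows. [folklore] -/
theorem boxHg1201E_M19P10_slice3_mem_iff (p : OneBandCoord → ℝ) :
    (boxHg1201E_M19P10_slice3 ulo uhi tlo thi nlo nhi hu ht hn).Mem p ↔
      ((ulo : ℝ) ≤ p .UOverT ∧ p .UOverT ≤ (uhi : ℝ)) ∧ ((tlo : ℝ) ≤ p .tpOverT ∧ p .tpOverT ≤ (thi : ℝ)) ∧
      ((nlo : ℝ) ≤ p .filling ∧ p .filling ≤ (nhi : ℝ)) ∧
      ((((51/100) : ℚ) : ℝ) ≤ p .tEV ∧ p .tEV ≤ (((17/25) : ℚ) : ℝ)) ∧ (((0 : ℚ) : ℝ) ≤ p .tppOverT ∧ p .tppOverT ≤ ((0 : ℚ) : ℝ)) := by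
  unfold boxHg1201E_M19P10_slice3
  rw [Box.mem_withEntry_iff]
  constructor
  · rintro ⟨hN, h⟩
    have hT := h .tpOverT (by decide) _ (by rw [Box.withEntry_self])
    have hrest : ∀ j, j ≠ OneBandCoord.filling → j ≠ OneBandCoord.tpOverT → ∀ f,
        (boxHg1201E_M19P10.withEntry .UOverT (Entry.ofEnds ulo uhi hu .screening)) j = some f → f.Mem (p j) := by
      intro j hj1 hj2 f hf
      exact h j hj1 f (by rw [Box.withEntry_of_ne _ _ hj2]; exact hf)
    have hU := hrest .UOverT (by decide) (by decide) _ (Box.withEntry_self _ _ _)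
    have ht' := hrest .tEV (by decide) (by decide) hg1201E_M19P10_t (by rw [Box.withEntry_of_ne _ _ (by decide)]; rfl)
    have htpp := hrest .tppOverT (by decide) (by decide) hg1201E_M19P10_tpp (by rw [Box.withEntry_of_ne _ _ (by decide)]; rfl)
    exact ⟨(Entry.mem_ofEnds_iff _ _ _ _ _).1 hU, (Entry.mem_ofEnds_iff _ _ _ _ _).1 hT, (Entry.mem_ofEnds_iff _ _ _ _ _).1 hN,
      (Entry.mem_ofEnds_iff _ _ _ _ _).1 ht', (Entry.mem_ofEnds_iff _ _ _ _ _).1 htpp⟩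
  · rintro ⟨hU, hT, hN, ht', htpp⟩
    refine ⟨(Entry.mem_ofEnds_iff _ _ _ _ _).2 hN, ?_⟩
    intro j hj f hf
    by_cases hjt : j = OneBandCoord.tpOverT
    · subst hjt
      rw [Box.withEntry_self] at hf
      cases hf
      exact (Entry.mem_ofEnds_iff _ _ _ _ _).2 hT
    · rw [Box.withEntry_of_ne _ _ hjt] at hf
      by_cases hju : j = OneBandCoord.UOverT
      · subst hju
        rw [Box.withEntry_self] at hf
        cases hf
        exact (Entry.mem_ofEnds_iff _ _ _ _ _).2 hU
      · rw [Box.withEntry_of_ne _ _ hju] at hf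
        cases j <;> simp only [boxHg1201E_M19P10, Option.some.injEq, reduceCtorEq, ne_eq, not_true_eq_false] at hf hj hjt hju <;>
          subst hf
        · exact (Entry.mem_ofEnds_iff _ _ _ _ _).2 ht'
        · exact (Entry.mem_ofEnds_iff _ _ _ _ _).2 htpp

/-- **INWARD ⇒ refines the typed @10 box** (`[ulo, uhi] ⊆ [3, 17/2]`, `[tlo, thi] ⊆ [−49/100, −7/20]`, `[nlo, nhi] ⊆ [4/5, 22/25]`), and with `79/100 ≤ nlo` it refines
the box OF RECORD `boxHg1201E_M19P10nR`. [folklore] -/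
theorem boxHg1201E_M19P10_slice3_refines (hu1 : 3 ≤ ulo) (hu2 : uhi ≤ 17/2) (ht1 : -49/100 ≤ tlo) (ht2 : thi ≤ -7/20) (hn2 : nhi ≤ 22/25) :
    (4/5 ≤ nlo → (boxHg1201E_M19P10_slice3 ulo uhi tlo thi nlo nhi hu ht hn).Refines boxHg1201E_M19P10) ∧
    (79/100 ≤ nlo → (boxHg1201E_M19P10_slice3 ulo uhi tlo thi nlo nhi hu ht hn).Refines boxHg1201E_M19P10nR) := by
  have hu1' : (((3 : ℚ)) : ℝ) ≤ (ulo : ℝ) := by exact_mod_cast hu1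
  have hu2' : ((uhi : ℚ) : ℝ) ≤ (((17/2 : ℚ)) : ℝ) := by exact_mod_cast hu2
  have ht1' : (((-49/100 : ℚ)) : ℝ) ≤ (tlo : ℝ) := by exact_mod_cast ht1
  have ht2' : ((thi : ℚ) : ℝ) ≤ (((-7/20 : ℚ)) : ℝ) := by exact_mod_cast ht2
  have hn2' : ((nhi : ℚ) : ℝ) ≤ (((22/25 : ℚ)) : ℝ) := by exact_mod_cast hn2
  constructor
  · intro hn1 p hp
    have hn1' : (((4/5 : ℚ)) : ℝ) ≤ (nlo : ℝ) := by exact_mod_cast hn1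
    obtain ⟨⟨a0, b0⟩, ⟨a1, b1⟩, ⟨a2, b2⟩, ⟨a3, b3⟩, ⟨a4, b4⟩⟩ := (boxHg1201E_M19P10_slice3_mem_iff hu ht hn p).1 hp
    exact (boxHg1201E_M19P10_mem_iff p).2 ⟨hu1'.trans a0, b0.trans hu2', ht1'.trans a1, b1.trans ht2', hn1'.trans a2, b2.trans hn2', a3, b3, a4, b4⟩
  · intro hn1 p hp
    have hn1' : (((79/100 : ℚ)) : ℝ) ≤ (nlo : ℝ) := by exact_mod_cast hn1
    obtain ⟨⟨a0, b0⟩, ⟨a1, b1⟩, ⟨a2, b2⟩, ⟨a3, b3⟩, ⟨a4, b4⟩⟩ := (boxHg1201E_M19P10_slice3_mem_iff hu ht hn p).1 hp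
    exact (boxHg1201E_M19P10nR_mem_iff p).2 ⟨⟨hn1'.trans a2, b2.trans hn2'⟩, ⟨hu1'.trans a0, b0.trans hu2'⟩, ⟨ht1'.trans a1, b1.trans ht2'⟩, ⟨a3, b3⟩, ⟨a4, b4⟩⟩

/-- **Monotone in all six ends.** [folklore] -/
theorem boxHg1201E_M19P10_slice3_mono {ulo' uhi' tlo' thi' nlo' nhi' : ℚ} (hu' : ulo' ≤ uhi') (ht' : tlo' ≤ thi') (hn' : nlo' ≤ nhi')
    (h1 : ulo' ≤ ulo) (h2 : uhi ≤ uhi') (h3 : tlo' ≤ tlo) (h4 : thi ≤ thi') (h5 : nlo' ≤ nlo) (h6 : nhi ≤ nhi') :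
    (boxHg1201E_M19P10_slice3 ulo uhi tlo thi nlo nhi hu ht hn).Refines (boxHg1201E_M19P10_slice3 ulo' uhi' tlo' thi' nlo' nhi' hu' ht' hn') := by
  intro p hp
  obtain ⟨⟨a0, b0⟩, ⟨a1, b1⟩, ⟨a2, b2⟩, hrest⟩ := (boxHg1201E_M19P10_slice3_mem_iff hu ht hn p).1 hp
  have h1' : ((ulo' : ℚ) : ℝ) ≤ (ulo : ℝ) := by exact_mod_cast h1
  have h2' : ((uhi : ℚ) : ℝ) ≤ (uhi' : ℝ) := by exact_mod_cast h2
  have h3' : ((tlo' : ℚ) : ℝ) ≤ (tlo : ℝ) := by exact_mod_cast h3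
  have h4' : ((thi : ℚ) : ℝ) ≤ (thi' : ℝ) := by exact_mod_cast h4
  have h5' : ((nlo' : ℚ) : ℝ) ≤ (nlo : ℝ) := by exact_mod_cast h5
  have h6' : ((nhi : ℚ) : ℝ) ≤ (nhi' : ℝ) := by exact_mod_cast h6
  exact (boxHg1201E_M19P10_slice3_mem_iff hu' ht' hn' p).2
    ⟨⟨h1'.trans a0, b0.trans h2'⟩, ⟨h3'.trans a1, b1.trans h4'⟩, ⟨h5'.trans a2, b2.trans h6'⟩, hrest⟩

/-- **THE BANKING DOOR @10 (word)**: a cell leaf on the rectangle IS the stiffness word on the slice. [cite: ScalapinoWhiteZhang1993, §II] -/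
theorem boxHg1201E_M19P10_slice3_stiffnessWord_of_cellLeaf {c : ℚ}
    (hW : ∀ tp ∈ Set.Icc (tlo : ℝ) thi, ∀ U ∈ Set.Icc (ulo : ℝ) uhi, ∀ n ∈ Set.Icc (nlo : ℝ) nhi, ObsStiffnessSeqCeilingAt tp U n c) :
    HoldsOn (fun p : OneBandCoord → ℝ => ObsStiffnessSeqCeilingAt (p .tpOverT) (p .UOverT) (p .filling) c)
      (boxHg1201E_M19P10_slice3 ulo uhi tlo thi nlo nhi hu ht hn) := by
  intro p hp
  obtain ⟨hU, hT, hN, -, -⟩ := (boxHg1201E_M19P10_slice3_mem_iff hu ht hn p).1 hp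
  exact hW _ hT _ hU _ hN

/-- **THE BANKING DOOR @10 (grammar)**: a cell leaf with `c ≤ bar` gives `StiffnessBoxCeilingBelow (slice3 …) bar`. [cite: ScalapinoWhiteZhang1993, §II] -/
theorem boxHg1201E_M19P10_slice3_stiffnessBoxCeilingBelow_of_cellLeaf {c bar : ℚ} (hc : c ≤ bar)
    (hW : ∀ tp ∈ Set.Icc (tlo : ℝ) thi, ∀ U ∈ Set.Icc (ulo : ℝ) uhi, ∀ n ∈ Set.Icc (nlo : ℝ) nhi, ObsStiffnessSeqCeilingAt tp U n c) :
    StiffnessBoxCeilingBelow (boxHg1201E_M19P10_slice3 ulo uhi tlo thi nlo nhi hu ht hn) bar :=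
  stiffnessBoxCeilingBelow_of_holdsOn hc (boxHg1201E_M19P10_slice3_stiffnessWord_of_cellLeaf hu ht hn hW)

/-- The dummy point lies in the @10 rectangle whenever its three coordinates do. [folklore] -/
theorem hg1201E_padPointP10_mem_slice3 {U tp n : ℝ} (hU : (ulo : ℝ) ≤ U ∧ U ≤ uhi) (htp : (tlo : ℝ) ≤ tp ∧ tp ≤ thi) (hN : (nlo : ℝ) ≤ n ∧ n ≤ nhi) :
    (boxHg1201E_M19P10_slice3 ulo uhi tlo thi nlo nhi hu ht hn).Mem (hg1201E_padPointP10 U tp n) := by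
  obtain ⟨eU, etp, en, et, etpp⟩ := hg1201E_padPointP10_apply U tp n
  refine (boxHg1201E_M19P10_slice3_mem_iff hu ht hn _).2 ⟨?_, ?_, ?_, ?_, ?_⟩
  · rw [eU]; exact hU
  · rw [etp]; exact htp
  · rw [en]; exact hN
  · rw [et]; constructor <;> norm_num
  · rw [etpp]; constructor <;> norm_num

/-- **THE INVERSE BANKING DOOR @10**: a stiffness word on a rectangle IS the cell leaf on it. [cite: ScalapinoWhiteZhang1993, §II] -/
theorem cellLeaf_of_boxHg1201E_M19P10_slice3_word {c : ℚ}
    (h : HoldsOn (fun p : OneBandCoord → ℝ => ObsStiffnessSeqCeilingAt (p .tpOverT) (p .UOverT) (p .filling) c)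
      (boxHg1201E_M19P10_slice3 ulo uhi tlo thi nlo nhi hu ht hn)) :
    ∀ tp ∈ Set.Icc (tlo : ℝ) thi, ∀ U ∈ Set.Icc (ulo : ℝ) uhi, ∀ n ∈ Set.Icc (nlo : ℝ) nhi, ObsStiffnessSeqCeilingAt tp U n c := by
  intro tp htp U hU n hN
  have hmem := hg1201E_padPointP10_mem_slice3 hu ht hn (U := U) (tp := tp) (n := n) ⟨hU.1, hU.2⟩ ⟨htp.1, htp.2⟩ ⟨hN.1, hN.2⟩
  have hw := h (hg1201E_padPointP10 U tp n) hmem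
  obtain ⟨eU, etp, en, -, -⟩ := hg1201E_padPointP10_apply U tp n
  simp only [eU, etp, en] at hw
  exact hw

/-- A grammar word on an @10 rectangle unfolded to a cell leaf with its constant. [cite: ScalapinoWhiteZhang1993, §II] -/
theorem cellLeaf_of_boxHg1201E_M19P10_slice3_stiffnessBoxCeilingBelow {bar : ℚ}
    (h : StiffnessBoxCeilingBelow (boxHg1201E_M19P10_slice3 ulo uhi tlo thi nlo nhi hu ht hn) bar) :
    ∃ c : ℚ, c ≤ bar ∧ ∀ tp ∈ Set.Icc (tlo : ℝ) thi, ∀ U ∈ Set.Icc (ulo : ℝ) uhi, ∀ n ∈ Set.Icc (nlo : ℝ) nhi, ObsStiffnessSeqCeilingAt tp U n c := by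
  obtain ⟨c, hc, hW⟩ := h
  exact ⟨c, hc, cellLeaf_of_boxHg1201E_M19P10_slice3_word hu ht hn hW⟩

/-! ## §2 Every @10 rectangle avoiding the padding corner is certificate-free (ANY `U` ends) -/

/-- **BELOW THE @10 FILLING CUT**: `t′ ⊆ [−49/100, −7/20]`, `n ⊆ [0, 43/50]`, any `U` ends ⇒ `StiffnessBoxCeilingBelow (slice3 …) (4767609/10⁷)` state-free
(box-2 `hg1201M19P10_bar_kinematic_of_n_le_43o50`). [cite: HazraVermaRanderia2019, eqs. (2)-(6)] -/
theorem boxHg1201E_M19P10_slice3_belowCut_stiffnessBoxCeilingBelow (ht1 : -49/100 ≤ tlo) (ht2 : thi ≤ -7/20) (hn0 : 0 ≤ nlo) (hcut : nhi ≤ 43/50) :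
    StiffnessBoxCeilingBelow (boxHg1201E_M19P10_slice3 ulo uhi tlo thi nlo nhi hu ht hn) (4767609 / 10000000) := by
  refine boxHg1201E_M19P10_slice3_stiffnessBoxCeilingBelow_of_cellLeaf hu ht hn le_rfl fun tp htp U _ n hN => ?_
  have ht1' : (-49 / 100 : ℝ) ≤ (tlo : ℝ) := by have := (Rat.cast_le (K := ℝ)).2 ht1; push_cast at this; linarith
  have ht2' : ((thi : ℚ) : ℝ) ≤ -7 / 20 := by have := (Rat.cast_le (K := ℝ)).2 ht2; push_cast at this; linarith
  have hn0' : (0 : ℝ) ≤ (nlo : ℝ) := by exact_mod_cast hn0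
  have hcut' : ((nhi : ℚ) : ℝ) ≤ 43 / 50 := by have := (Rat.cast_le (K := ℝ)).2 hcut; push_cast at this; linarith
  exact hg1201M19P10_bar_kinematic_of_n_le_43o50 ⟨ht1'.trans htp.1, htp.2.trans ht2'⟩ (hn0'.trans hN.1) (hN.2.trans hcut')

/-- **ON THE INNER t′ SIDE @10**: `t′ ⊆ [−47/100, −7/20]`, `n ⊆ [0, 22/25]`, any `U` ends ⇒ certificate-free (box-2 `hg1201M19P10_bar_kinematic_of_m47o100_le_tp`).
[cite: HazraVermaRanderia2019, eqs. (2)-(6)] -/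
theorem boxHg1201E_M19P10_slice3_innerTp_stiffnessBoxCeilingBelow (ht1 : -47/100 ≤ tlo) (ht2 : thi ≤ -7/20) (hn0 : 0 ≤ nlo) (hn2 : nhi ≤ 22/25) :
    StiffnessBoxCeilingBelow (boxHg1201E_M19P10_slice3 ulo uhi tlo thi nlo nhi hu ht hn) (4767609 / 10000000) := by
  refine boxHg1201E_M19P10_slice3_stiffnessBoxCeilingBelow_of_cellLeaf hu ht hn le_rfl fun tp htp U _ n hN => ?_
  have ht1' : (-47 / 100 : ℝ) ≤ (tlo : ℝ) := by have := (Rat.cast_le (K := ℝ)).2 ht1; push_cast at this; linarith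
  have ht2' : ((thi : ℚ) : ℝ) ≤ -7 / 20 := by have := (Rat.cast_le (K := ℝ)).2 ht2; push_cast at this; linarith
  have hn0' : (0 : ℝ) ≤ (nlo : ℝ) := by exact_mod_cast hn0
  have hn2' : ((nhi : ℚ) : ℝ) ≤ 22 / 25 := by have := (Rat.cast_le (K := ℝ)).2 hn2; push_cast at this; linarith
  exact hg1201M19P10_bar_kinematic_of_m47o100_le_tp ⟨ht1'.trans htp.1, htp.2.trans ht2'⟩ (hn0'.trans hN.1) (hN.2.trans hn2')

end

/-! ## §1′ The @10 padding-corner rectangles `R′₁₀` (of record) and `R″₁₀` (after the t′-cut −12/25), refinements, volume fractions -/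

/-- **`boxHg1201E_M19P10_Rprime`** — the @10 certificate strip of record as a typed rectangle: `U ∈ [3, 17/2] × t′ ∈ [−49/100, −47/100] × n ∈ [43/50, 22/25]`
(captain RULING «n_k′ = 43/50», hubbard-obs STATUS 09:00:42Z; t′ side = box-2's P0 cover corner `t* = −47/100`, p610598). [folklore] -/
def boxHg1201E_M19P10_Rprime : OneBandBox :=
  boxHg1201E_M19P10_slice3 3 (17/2) (-49/100) (-47/100) (43/50) (22/25) (by norm_num) (by norm_num) (by norm_num)

/-- **`boxHg1201E_M19P10_Rsecond`** — the @10 strip after the adopted t′-cut `t*′ = −12/25` («TP-KINCUT»): `U ∈ [3, 17/2] × t′ ∈ [−49/100, −12/25] × n ∈ [43/50, 22/25]`. [folklore] -/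
def boxHg1201E_M19P10_Rsecond : OneBandBox :=
  boxHg1201E_M19P10_slice3 3 (17/2) (-49/100) (-12/25) (43/50) (22/25) (by norm_num) (by norm_num) (by norm_num)

/-- `R″₁₀ ⊆ R′₁₀ ⊆ boxHg1201E_M19P10 ⊆ boxHg1201E_M19P10nR` (the last by p609726's `boxHg1201E_M19P10_refines_nR`). [folklore] -/
theorem boxHg1201E_M19P10_Rprime_refines :
    boxHg1201E_M19P10_Rsecond.Refines boxHg1201E_M19P10_Rprime ∧ boxHg1201E_M19P10_Rprime.Refines boxHg1201E_M19P10 ∧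
    boxHg1201E_M19P10_Rsecond.Refines boxHg1201E_M19P10 ∧ boxHg1201E_M19P10_Rprime.Refines boxHg1201E_M19P10nR :=
  ⟨boxHg1201E_M19P10_slice3_mono _ _ _ _ _ _ le_rfl le_rfl le_rfl (by norm_num) le_rfl le_rfl,
    (boxHg1201E_M19P10_slice3_refines _ _ _ le_rfl le_rfl le_rfl (by norm_num) le_rfl).1 (by norm_num),
    (boxHg1201E_M19P10_slice3_refines _ _ _ le_rfl le_rfl le_rfl (by norm_num) le_rfl).1 (by norm_num),
    (boxHg1201E_M19P10_slice3_refines _ _ _ le_rfl le_rfl le_rfl (by norm_num) le_rfl).2 (by norm_num)⟩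

/-- **Volume fractions @10 (arithmetic)**: `(t′, n)` face of the typed box `[−49/100, −7/20] × [4/5, 22/25]` (widths `7/50 × 2/25`): `R′₁₀` = `(1/50)/(7/50) × (1/50)/(2/25)
= (1/7)(1/4) = 1/28`, `R″₁₀` = `(1/100)/(7/50) × 1/4 = (1/14)(1/4) = 1/56`; relative to the box OF RECORD (`n ∈ [79/100, 22/25]`, width `9/100`): `(1/7)(2/9) = 2/63` and
`(1/14)(2/9) = 1/63`. [folklore] -/
theorem hg1201E_M19P10_paddingCorner_fractions :
    ((-47/100 : ℚ) - (-49/100)) / ((-7/20) - (-49/100)) = 1/7 ∧ ((22/25 : ℚ) - 43/50) / (22/25 - 4/5) = 1/4 ∧ (1/7 : ℚ) * (1/4) = 1/28 ∧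
    ((-12/25 : ℚ) - (-49/100)) / ((-7/20) - (-49/100)) = 1/14 ∧ (1/14 : ℚ) * (1/4) = 1/56 ∧
    ((22/25 : ℚ) - 43/50) / (22/25 - 79/100) = 2/9 ∧ (1/7 : ℚ) * (2/9) = 2/63 ∧ (1/14 : ℚ) * (2/9) = 1/63 := by
  norm_num

/-! ## §3 THE @10 LEAF ≡ THE WORD ON `R′₁₀` (and on `R″₁₀`, given the t′-cut) -/

/-- **«MOS2-hg1201-M19P10» ⇔ the grammar word on `R′₁₀` alone** ((⇒) refinement; (⇐) inverse door + box-2's `Hg1201M19P10_StiffnessBoxCeiling_of_cornerStrip`). The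
certificate programme of route `CovHg1201M19P10` (items 27104/27105, via that route's `closes`) coincides, in box grammar, with ONE rectangle word on `1/28` of the
typed @10 box (`2/63` of the box of record) — t′ print/INFL-P pad × filling CIRC pad. [cite: ScalapinoWhiteZhang1993, §II] [cite: HazraVermaRanderia2019, eqs. (2)-(6)] -/
theorem Hg1201M19P10_StiffnessBoxCeiling_iff_RprimeWord :
    Hg1201M19P10_StiffnessBoxCeiling ↔ StiffnessBoxCeilingBelow boxHg1201E_M19P10_Rprime (4767609 / 10000000) := by
  constructor
  · exact fun h => stiffnessBoxCeilingBelow_of_refines h boxHg1201E_M19P10_Rprime_refines.2.1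
  · intro h
    obtain ⟨c, hc, hW⟩ := cellLeaf_of_boxHg1201E_M19P10_slice3_stiffnessBoxCeilingBelow _ _ _ h
    refine Hg1201M19P10_StiffnessBoxCeiling_of_cornerStrip hc fun tp htp U hU n hN => ?_
    refine hW tp ?_ U ?_ n ?_ <;> push_cast <;> first | exact htp | exact hU | exact hN

/-- **Given the @10 t′-cut, «MOS2-hg1201-M19P10» ⇔ the grammar word on `R″₁₀` alone.** Hypothesis `hTp` = the kinematic slab on `t′ ∈ [−12/25, −7/20] × n ∈ [0, 22/25]`
at the P10 bar, every `U` (the shape of box-2's theorem for the «TP-KINCUT» row `B(−12/25, 4273/8192) ≤ 0.2456919725` — ordered, NOT in the tree at this writing).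
Then the programme coincides with ONE rectangle word on `1/56` of the typed box. [cite: ScalapinoWhiteZhang1993, §II] [cite: HazraVermaRanderia2019, eqs. (2)-(6)] -/
theorem Hg1201M19P10_StiffnessBoxCeiling_iff_RsecondWord_of_tpCut
    (hTp : ∀ {tp U n : ℝ}, tp ∈ Set.Icc (-12 / 25 : ℝ) (-7 / 20) → 0 ≤ n → n ≤ 22 / 25 →
      ObsStiffnessSeqCeilingAt tp U n (4767609 / 10000000)) :
    Hg1201M19P10_StiffnessBoxCeiling ↔ StiffnessBoxCeilingBelow boxHg1201E_M19P10_Rsecond (4767609 / 10000000) := by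
  constructor
  · exact fun h => stiffnessBoxCeilingBelow_of_refines h boxHg1201E_M19P10_Rprime_refines.2.2.1
  · intro h
    obtain ⟨c, hc, hW⟩ := cellLeaf_of_boxHg1201E_M19P10_slice3_stiffnessBoxCeilingBelow _ _ _ h
    refine Hg1201M19P10_StiffnessBoxCeiling_of_cornerStrip (c := 4767609 / 10000000) le_rfl fun tp htp U hU n hN => ?_
    rcases le_or_gt (-12 / 25 : ℝ) tp with htc | htc
    · exact hTp ⟨htc, by linarith [htp.2]⟩ (by linarith [hN.1]) hN.2
    · refine (hW tp ?_ U ?_ n ?_).mono hc <;> push_cast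
      · exact ⟨htp.1, htc.le⟩
      · exact hU
      · exact hN

/-- **Downward, for the producers @10**: a certified `c ≤ 0.4767609` cell leaf on `R′₁₀` IS the `R′₁₀` word, hence the leaf, hence the `R″₁₀` word.
[cite: ScalapinoWhiteZhang1993, §II] -/
theorem boxHg1201E_M19P10_Rprime_stiffnessBoxCeilingBelow_of_cellLeaf {c : ℚ} (hc : c ≤ 4767609 / 10000000)
    (h : ∀ tp ∈ Icc (-49 / 100 : ℝ) (-47 / 100), ∀ U ∈ Icc (3 : ℝ) (17 / 2), ∀ n ∈ Icc (43 / 50 : ℝ) (22 / 25), ObsStiffnessSeqCeilingAt tp U n c) :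
    StiffnessBoxCeilingBelow boxHg1201E_M19P10_Rprime (4767609 / 10000000) ∧ Hg1201M19P10_StiffnessBoxCeiling ∧
    StiffnessBoxCeilingBelow boxHg1201E_M19P10_Rsecond (4767609 / 10000000) := by
  have hR : StiffnessBoxCeilingBelow boxHg1201E_M19P10_Rprime (4767609 / 10000000) := by
    refine boxHg1201E_M19P10_slice3_stiffnessBoxCeilingBelow_of_cellLeaf _ _ _ hc fun tp htp U hU n hN => h tp ?_ U ?_ n ?_ <;>
      push_cast at htp hU hN <;> first | exact htp | exact hU | exact hN
  have hleaf := Hg1201M19P10_StiffnessBoxCeiling_iff_RprimeWord.2 hR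
  exact ⟨hR, hleaf, stiffnessBoxCeilingBelow_of_refines hleaf boxHg1201E_M19P10_Rprime_refines.2.2.1⟩

end Summit.Ventures.CertifiedManyBodySolver.Downfold

end
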